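import Summits.Ventures.PercRepro.C025ProfileGirthRowsAll

/-!
# THE HALL FORM OF EVERY ROW AT GIRTH `≥ q+1`: THE FAT FAMILIES, AND THE REDUCTION TO THIN FAMILIES (night-3 g21)

The Hall form (C-033) of the row `(q, u)` asks, for EVERY family `𝒜` of rank-`q` sets, that the level-`u` sets
containing a member of `𝒜` (`Shadow.shadowLevel`) number at least the total price of `𝒜`.  At girth `≥ q + 1` the
companion module pays every FAT rank-`q` set `X` (`≥ q + 1` points) by its `j`-sets `X ∪ Y` (`fatIneq_all`); that
injection is LOCAL — each `X ∪ Y` contains `X` — so it gives the Hall inequality for every family of fat sets: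
* **`sum_price_le_card_shadow_of_fat`** — `Σ_{X ∈ 𝒜} price_{q,q+j}(X) ≤ #shadowLevel (q+j) 𝒜` for every family `𝒜` of
  rank-`q` sets with `≥ q + 1` points (the `j`-sets of distinct fat sets are distinct, `eq_of_union_jset_eq`);
* **`hallIneq_of_thin_clean`** — the REDUCTION: the Hall form of the row `(q, q+j)` at girth `≥ q + 1` follows from
  the Hall inequality for families `𝒯` of INDEPENDENT `q`-sets with CLEAN supply (level sets containing no rank-`q`
  subset with `≥ q + 1` points): the clean shadow of the thin part and the shadow of the fat part are disjoint.
What is NOT claimed: the thin Hall inequality itself (open; the dual count of the companion module does not localise).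
No `def`, no `instance`, no notation.  Axioms: standard.
-/

open scoped Matroid

namespace PercRepro

open Set Finset ThmH Staged

namespace GirthHall

variable {α : Type} [DecidableEq α] {M : Matroid α} [M.Finite]

/-- **The Hall inequality for every family of fat sets at girth `≥ q + 1`**: a family `𝒜` of rank-`q` sets with
`≥ q + 1` points has total price at most the number of level-`(q+j)` sets containing a member of `𝒜` — each `X ∈ 𝒜`
is paid by its `j`-sets `X ∪ Y` (`price_le_card_jsets`), which contain `X`, and distinct pairs `(X, Y)` give distinct
sets (`eq_of_union_jset_eq`). -/
theorem sum_price_le_card_shadow_of_fat {q j : ℕ} (hq : 1 ≤ q) (hg : ∀ T ⊆ M.E, T.encard ≤ q → M.Indep T)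
    {𝒜 : Finset (Finset α)} (h𝒜 : 𝒜 ⊆ Profile.Rq M q) (hfat : ∀ B ∈ 𝒜, q + 1 ≤ B.card) :
    ∑ B ∈ 𝒜, Profile.price M q (q + j) B ≤ ((Shadow.shadowLevel M (q + j) 𝒜).card : ℚ) := by
  have hmem : ∀ B ∈ 𝒜, B ⊆ gr M ∧ rkN M B = q ∧ q + 1 ≤ B.card := by
    intro B hB
    have h := Profile.mem_Rq.1 (h𝒜 hB)
    exact ⟨h.1, by rw [Staged.rkN_eq_iff]; exact h.2, hfat B hB⟩
  have h1 : ∑ B ∈ 𝒜, Profile.price M q (q + j) B ≤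
      ∑ B ∈ 𝒜, ((((gr M \ B).powersetCard j).filter (fun Y => rkN M (B ∪ Y) = q + j)).card : ℚ) := by
    apply Finset.sum_le_sum
    intro B hB
    exact GirthRows.price_le_card_jsets (hmem B hB).1 (hmem B hB).2.1
  have h2 : ∑ B ∈ 𝒜, ((((gr M \ B).powersetCard j).filter (fun Y => rkN M (B ∪ Y) = q + j)).card : ℚ) =
      ((𝒜.sigma (fun B => ((gr M \ B).powersetCard j).filter (fun Y => rkN M (B ∪ Y) = q + j))).card : ℚ) := by
    rw [Finset.card_sigma]
    push_cast
    rfl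
  have h3 : (𝒜.sigma (fun B => ((gr M \ B).powersetCard j).filter (fun Y => rkN M (B ∪ Y) = q + j))).card ≤
      (Shadow.shadowLevel M (q + j) 𝒜).card := by
    apply Finset.card_le_card_of_injOn (fun a : (Σ _ : Finset α, Finset α) => a.1 ∪ a.2)
    · intro a ha
      rw [Finset.mem_coe, Finset.mem_sigma] at ha
      obtain ⟨hBg, _, hBc⟩ := hmem a.1 ha.1
      rw [Finset.mem_coe, mem_shadowLevel]
      exact ⟨(GirthRows.union_jset_mem_levelSet hBg hBc ha.2).1, a.1, ha.1, Finset.subset_union_left⟩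
    · intro a ha a' ha' heq
      rw [Finset.mem_coe, Finset.mem_sigma] at ha ha'
      obtain ⟨hBg, hBr, _⟩ := hmem a.1 ha.1
      obtain ⟨hB'g, hB'r, hB'c⟩ := hmem a'.1 ha'.1
      simp only at heq
      have hB : a.1 = a'.1 := GirthRows.eq_of_union_jset_eq hq hg hBg hB'g hBr hB'r hB'c ha.2 ha'.2 heq
      have hYd : ∀ (B Y : Finset α), Y ∈ ((gr M \ B).powersetCard j).filter (fun Y => rkN M (B ∪ Y) = q + j) →
          (B ∪ Y) \ B = Y := by
        intro B Y hY
        rw [Finset.mem_filter, Finset.mem_powersetCard] at hY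
        apply Finset.union_sdiff_cancel_left
        rw [Finset.disjoint_left]
        intro z hzB hzY
        exact (Finset.mem_sdiff.1 (hY.1.1 hzY)).2 hzB
      have hY : a.2 = a'.2 := by
        rw [← hYd a.1 a.2 ha.2, ← hYd a'.1 a'.2 ha'.2, heq, hB]
      exact Sigma.ext hB (heq_of_eq hY)
  calc ∑ B ∈ 𝒜, Profile.price M q (q + j) B
      ≤ ∑ B ∈ 𝒜, ((((gr M \ B).powersetCard j).filter (fun Y => rkN M (B ∪ Y) = q + j)).card : ℚ) := h1
    _ = _ := h2
    _ ≤ _ := by exact_mod_cast h3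

open scoped Classical in
/-- **The reduction of the Hall form to thin families with clean supply.**  If every family `𝒯` of independent
`q`-sets has total price at most the number of CLEAN level-`(q+j)` sets containing a member of `𝒯` (clean: no
rank-`q` subset with `≥ q + 1` points), then the Hall form of the row `(q, q+j)` holds at girth `≥ q + 1`: a family
`𝒜` splits into its thin part `𝒯` and its fat part `ℱ`; the clean shadow of `𝒯` and the shadow of `ℱ` are disjoint
(a set above a fat member is not clean) and both lie in the shadow of `𝒜`. -/
theorem hallIneq_of_thin_clean {q j : ℕ} (hq : 1 ≤ q) (hg : ∀ T ⊆ M.E, T.encard ≤ q → M.Indep T)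
    (hthin : ∀ 𝒯 ⊆ (Profile.Rq M q).filter (fun B : Finset α => B.card = q),
      ∑ B ∈ 𝒯, Profile.price M q (q + j) B ≤
        (((Shadow.shadowLevel M (q + j) 𝒯).filter
          (fun S : Finset α => ∀ X ⊆ S, rkN M X = q → X.card ≤ q)).card : ℚ)) :
    Profile.HallIneq M q (q + j) := by
  intro 𝒜 h𝒜
  have hT : 𝒜.filter (fun B : Finset α => B.card = q) ⊆ (Profile.Rq M q).filter (fun B : Finset α => B.card = q) := by
    intro B hB
    rw [Finset.mem_filter] at hB ⊢
    exact ⟨h𝒜 hB.1, hB.2⟩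
  have hF : 𝒜.filter (fun B : Finset α => ¬ B.card = q) ⊆ Profile.Rq M q :=
    fun B hB => h𝒜 (Finset.mem_filter.1 hB).1
  have hFfat : ∀ B ∈ 𝒜.filter (fun B : Finset α => ¬ B.card = q), q + 1 ≤ B.card := by
    intro B hB
    rw [Finset.mem_filter] at hB
    have h1 : rkN M B ≤ B.card := Staged.rkN_le_card B
    have h2 : rkN M B = q := by
      rw [Staged.rkN_eq_iff]
      exact (Profile.mem_Rq.1 (h𝒜 hB.1)).2
    omega
  have hdisj : Disjoint
      ((Shadow.shadowLevel M (q + j) (𝒜.filter (fun B : Finset α => B.card = q))).filter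
        (fun S : Finset α => ∀ X ⊆ S, rkN M X = q → X.card ≤ q))
      (Shadow.shadowLevel M (q + j) (𝒜.filter (fun B : Finset α => ¬ B.card = q))) := by
    rw [Finset.disjoint_left]
    intro S hS1 hS2
    rw [Finset.mem_filter] at hS1
    obtain ⟨_, X, hXF, hXS⟩ := mem_shadowLevel.1 hS2
    have h1 := hS1.2 X hXS (by rw [Staged.rkN_eq_iff]; exact (Profile.mem_Rq.1 (hF hXF)).2)
    have h2 := hFfat X hXF
    omega
  have hsub :
      ((Shadow.shadowLevel M (q + j) (𝒜.filter (fun B : Finset α => B.card = q))).filter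
        (fun S : Finset α => ∀ X ⊆ S, rkN M X = q → X.card ≤ q)) ∪
      Shadow.shadowLevel M (q + j) (𝒜.filter (fun B : Finset α => ¬ B.card = q)) ⊆
        Shadow.shadowLevel M (q + j) 𝒜 := by
    intro S hS
    rw [Finset.mem_union] at hS
    rcases hS with hS | hS
    · rw [Finset.mem_filter] at hS
      obtain ⟨hSl, B, hB, hBS⟩ := mem_shadowLevel.1 hS.1
      exact mem_shadowLevel.2 ⟨hSl, B, (Finset.mem_filter.1 hB).1, hBS⟩
    · obtain ⟨hSl, B, hB, hBS⟩ := mem_shadowLevel.1 hS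
      exact mem_shadowLevel.2 ⟨hSl, B, (Finset.mem_filter.1 hB).1, hBS⟩
  calc ∑ B ∈ 𝒜, Profile.price M q (q + j) B
      = ∑ B ∈ 𝒜.filter (fun B : Finset α => B.card = q), Profile.price M q (q + j) B +
          ∑ B ∈ 𝒜.filter (fun B : Finset α => ¬ B.card = q), Profile.price M q (q + j) B :=
        (Finset.sum_filter_add_sum_filter_not 𝒜 (fun B : Finset α => B.card = q) _).symm
    _ ≤ (((Shadow.shadowLevel M (q + j) (𝒜.filter (fun B : Finset α => B.card = q))).filter
          (fun S : Finset α => ∀ X ⊆ S, rkN M X = q → X.card ≤ q)).card : ℚ) +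
        ((Shadow.shadowLevel M (q + j) (𝒜.filter (fun B : Finset α => ¬ B.card = q))).card : ℚ) :=
        add_le_add (hthin _ hT) (sum_price_le_card_shadow_of_fat hq hg hF hFfat)
    _ = ((((Shadow.shadowLevel M (q + j) (𝒜.filter (fun B : Finset α => B.card = q))).filter
          (fun S : Finset α => ∀ X ⊆ S, rkN M X = q → X.card ≤ q)) ∪
        Shadow.shadowLevel M (q + j) (𝒜.filter (fun B : Finset α => ¬ B.card = q))).card : ℚ) := by
        rw [Finset.card_union_of_disjoint hdisj]
        push_cast
        rfl
    _ ≤ _ := by exact_mod_cast Finset.card_le_card hsub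

end GirthHall

end PercRepro
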